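import Summits.Schanuel.Schanuel.Theorems.RootDecomp1KHyper15
import Summits.Schanuel.Schanuel.Theorems.RootDecomp1EScaleTransfer04

/-!
# RootDecomp1EPointTransfer — lens 2, generation 36 «POINT-TRANSFER CELL» (PointTransfer.lean v2 3559bc07…, 1387 l) — part 1 (RootDecomp1EPointTransfer01): §2 the named fact `Roy2014_thm_1_1` (`royS`, `royBound`); §3 the cut `HyperRatScale`, `InPointClass`-side instances; §3b frame data (`ℚ(y)`, denominator, house bound)

PORT NOTE (census-1 gen 15, 2026-08-31): port of HOME/decomp-schanuel-lens-2/g36/PointTransfer.lean v2 (sha256 3559bc07…2e21, 1387 l; own farm rc 0 · 0 warn ·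
0 sorry · axioms std; critic VERDICT STATUS L1667: checklist L1653 (i)(ii)(iii)(1)–(4) WITH (3b) MET, ONE cell-decision credit (E-R16 target) to lens-2 g36,
label NEW-COMBINATION, RULE E-R17; PORT GO LOW census lane; v2 ACK L1672; writer re-checks L1666/L1673) in FOUR parts `RootDecomp1EPointTransfer01`–`04`:
01 = §2 the INPUT `Roy2014_thm_1_1` (named fact, print-faithful, KEPT HERE as a by-name binder with its cite docstring — relocation to
Literature/NumberTheory/Transcendental is for a planner/typer to file, per critic L1667; census does not propose Literature) + §3 the cut `HyperRatScale` /
`InPointClass` + §3b frame data; 02 = §4 KERNEL `expPoly_ne_zero_of_hyperRatScale` + ENGINE `algebraicIndependent_exp_hyperLiouville_line` (lens-2 =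
OWNER engine module per the one-engine coordination L1661/L1667 — lens-4's HyperFrame kernels import THIS); 03 = §5 cells of 31409/31410/25020/31077 on
`InPointClass` + §6 members `z_H⁽⁴⁾`, `z_H⁽³⁾`; 04 = §6b plainness / items APPLIED + §7 rates + §7b SEPARATION `not_ultraLiouville_lambdaH` (the only part importing
`…Theses.RootDecomp1K`, for the two cross-route `item31077_applied_at_zH4/zH3` links; `…Theses.RootDecomp1E` is in the cone already). §1 and the other
g35 duplicates (`expPoly` block, `linearIndependent_scale/_of_scale`, the frame `s2`/`ω4`/`y3` with its certificates, `y3_zero/one/two`, `ih_at_three`)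
are DELETED and opened from the landed `RootDecomp1EScaleTransfer01/03/04`; §8 probes / axiom guards not ported (scaffolding; HOME + critic probe
PTprobe 127578e7…); `set_option linter.*` dropped; 28 one-line docstrings added; `exp_neg_le_one_div`, `isAlgebraic_I'`, `rat_sqrt_two`, `lambdaH_pos`,
`lambdaH_ne_zero` private; statements and proofs otherwise verbatim. `--supports stmt-Schanuel-31409`; no census credit. Nothing here proves Schanuel;
rung 0. The lens's header follows.
-/

/-!
# RootDecomp1E — lens 2, gen 36 «POINT TRANSFER»: Schanuel's bound ON THE LINES `ρ · ℚ̄ⁿ` FOR EVERY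
# HYPER-LIOUVILLE SCALE `ρ` (single-exponential type), modulo Roy's point-explicit Lindemann–Weierstrass
# measure (draft node file; see NODE-g36.md)

Route of record `route-Schanuel-RootDecomp1E` (DRAFT rev 25; items 31409 `EStableDefectOne` (first open
length `n = 4`), 31410 `PlainDefectOne` / 25020 `DefectOneSchanuel` (`S⁻`, first open length `n = 3`)).
Critic's standing target E-R16 (VERDICT STATUS L1636): «a decided cell of 31409/31410 whose scale datum is NOT
doubly-exponentially approximable through a number field — a degree-free mechanism».

## The input (NEW in the tree): Roy's point-explicit L–W measure, as a named-fact binder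

`Roy2014_thm_1_1` (§2) types PRINT-FAITHFULLY [Roy2014, Théorème 1.1, p. 2 of arXiv:1607.00579 =
L'Enseignement Math. 59 (2014) 287–306, doi:10.4171/lem/59-3-4; its homogeneous form is Thm 6.3, p. 13]:
for `α₁, …, α_t ∈ ℚ̄` ℚ-linearly independent, `c ≥` the absolute values of all their conjugates, `q ∈ ℕ⁺` with
`qα_i` algebraic integers, `d = [ℚ(α) : ℚ]`, and every `P ≠ 0` in `ℤ[X₁..X_t]` of degree `≤ D`, coefficients
`≤ H` in absolute value (`D, H ≥ 1`):  `|P(e^{α₁}, …, e^{α_t})| ≥ H^{−3dS^t} · exp(−(cqS)^{18 S^t})`,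
`S = 6dt(t!)D`.  It is carried as a hypothesis `(hRoy : Roy2014_thm_1_1)` exactly as the credited 1K cells
carry `hNW` / `h52` (a published theorem, not yet tree-proved; the tree's `LWMeasure` = Ably 1994 has the
same shape with UNEXPLICIT dependence on the point, which is why it could only feed g35's monomial transfer).

## The mechanism (NEW): POINT transfer — the polynomial stays FIXED, the L–W point MOVES

For `y ∈ ℚ̄ⁿ` ℚ-free and a scale `ξ`, `t ↦ P(e^{t y₁}, …, e^{t yₙ})` is Lipschitz near `ξ`; at a rational
approximant `r ≠ 0` of `ξ` the point `r·y` is AGAIN an algebraic ℚ-free point (the whole tuple scales —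
the homogeneity that the `(1, λ)` storey cells of the «LW-PAIR DEGREE WALL» (STATUS L1649/L1650) lack),
`ℚ(r·y) = ℚ(y)`, house and denominator of `r·y` are `≤ |num r|·(house, den of y)`, so Roy's bound reads
`|P(e^{r y})| ≥ H^{−X} exp(−(|num r|·A)^{E})` with `X, A, E` depending on `(y, P)` ONLY — the DEGREE of `P`
never changes (no monomial substitution), hence Ably/Roy's `exp(C·D^t·log D)` degree term is a CONSTANT here
and the doubly-exponential requirement of g35's `HyperScaleApprox` DISAPPEARS: the transfer closes as soon as
`|ξ − r| < exp(−(2 + |num r| + den r)^m)` for every `m` (`HyperRatScale ξ`, §3) — a SINGLE-exponential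
(finite order `m → ∞`, «hyper-Liouville») condition.  In particular (§3, `hyperRatScale_of_hyperLiouville`)
EVERY hyper-Liouville real `ρ` of the tree (`RootDecomp1KHyper.HyperCell.HyperLiouville`, lens 6's 1K class:
a dense `G_δ`, `dense_setOf_hyperLiouville`; explicit `λ_H`, `hyperLiouville_lambdaH`) is such a scale.

## Results (all mod `hRoy`; the members' certificates are hypothesis-free)

* §4 KERNEL `expPoly_ne_zero_of_hyperRatScale`, ENGINE `algebraicIndependent_exp_of_hyperRatScale`:
  `e^{ξ y₁}, …, e^{ξ yₙ}` are ALGEBRAICALLY INDEPENDENT for `y ∈ ℚ̄ⁿ` ℚ-free and `ξ` a hyper-rational scale —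
  `S` ITSELF (`trdeg ≥ n` from the exponentials alone) at EVERY length `n`; `sb_hyperLiouville_line`:
  Schanuel's bound at `ρ·y` for every hyper-Liouville `ρ`.
  `algebraicIndependent_exp_hyperLiouville_line` = the ENGINE in the critic's shape (ACK STATUS L1653 (2)):
  `(hRoy) (hyalg) (hy) (hρ : HyperLiouville ρ) : AlgebraicIndependent ℚ (fun j => cexp (ρ * y j))`;
  tightness `frame_free_necessary`, `scale_condition_necessary`.
* §5 THE CELL LINE `InPointClass z := ∃ ρ y, HyperLiouville ρ ∧ y algebraic ∧ y ℚ-free ∧ z = ρ·y` (the scale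
  predicate IS lens 6's TREE constant `RootDecomp1KHyper.HyperCell.HyperLiouville`); CELLS with the items'
  binders VERBATIM + `InPointClass z`: `defectOneSchanuel_pointCell` (25020), `eStableDefectOne_pointCell`
  (31409), `plainDefectOne_pointCell` (31410), and route 1K's `coordLiouvilleSchanuel_pointCell` (31077, S_L′);
  the engine's wider class `OnHyperLine` (hyper-RATIONAL complex scales); bottom rung = Lindemann–Weierstrass.
* §6 MEMBERS `z_H⁽⁴⁾ = λ_H·(1, √2, i, i√2)` (`n = 4`, E-stable by `√2`: 31409's first open length) and
  `z_H⁽³⁾ = λ_H·(1, √2, i)` (`n = 3`, plain): hypothesis-free certificates `zH4_inPointClass`, `zH4_eStable`,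
  `zH3_plain`, `zH4_coordLiouville`; `schanuel_at_zH4 : SB 4 zH4`, `schanuel_at_zH3 : SB 3 zH3` (mod hRoy only);
  LIVE items APPLIED / their instances PROVED: `item31409_applied/instance_at_zH4` (`…_at_zH4'`: the
  induction binder discharged too, via `InPointClass.of_mem_span` / `ih_of_inPointClass`),
  `item31410_applied/instance_at_zH3`, `item25020_applied/instance_at_zH3`, `item31077_applied/instance_at_zH4/zH3`.
* §7 RATES and SEPARATION (hypothesis-free): `UltraRatScale → HyperRatScale`; the member scale's convergents
  `s_K = M_K / 2^{a_K}` (`M_K` odd) satisfy `2^{−a_{K+1}} ≤ λ_H − s_K ≤ 2·2^{−a_{K+1}}`; `lambdaH_rat_lower`: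
  `|λ_H − p/q| ≥ exp(−exp(q³))` for EVERY rational with `q ≥ 2`; hence `not_ultraLiouville_lambdaH :
  ¬ UltraLiouville λ_H` (lens 4's doubly-exponential predicate, text verbatim) while `HyperLiouville λ_H` (tree):
  the member separates the point-transfer class from every doubly-exponential («through a number field») class.
* §8 PROBES: item texts `Iff.rfl` vs the LIVE decls 31409/31410/25020/31077, the cell line and scale predicates
  spelled out, positional links, engine standalone, `#print axioms` guards (std triple) on 18 decls.

Nothing here proves Schanuel's conjecture; rung 0.  §1 and the member algebra of §6 are adapted from the
lens-2 g35 draft `ScaleTransfer.lean` (same lineage); `λ_H` and `HyperLiouville` are lens 6's (tree).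
-/

noncomputable section

open Complex IntermediateField
open Summit.Schanuel.Schanuel.Theorems.RootDecomp1KHyper (SB SFset mvlen mvlen_nonneg abs_coeff_le_mvlen
  one_le_mvlen sb_of_algebraicIndependent exists_le_two_pow exists_int_mul_eq_map mvaeval_int_map
  mem_adjoin_SFset_I')
open Summit.Schanuel.Schanuel.Theorems.RootDecomp1KHyper.HyperCell (HyperLiouville hexp hexp_succ lambdaH
  hyperLiouville_lambdaH lambdaH_partialSum lambdaH_tail_pos lambdaH_tail_le lambdaH_eq_partialSum_add_tail
  summable_lambdaH succ_le_hexp one_le_hexp)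

-- PORT (census-1 gen 15): the g35 duplicates of this file (§1 `expPoly` block, `linearIndependent_scale` /
-- `linearIndependent_of_scale`, the frame `s2` / `ω4` / `y3` and its certificates, `y3_zero/one/two`, `ih_at_three`) are
-- DELETED and taken from the landed OWNER modules `RootDecomp1EScaleTransfer01/03/04` (critic L1667: one-engine coordination;
-- gate dedup lint); four private one-liners are kept as private copies.
open Summit.Schanuel.Schanuel.Theorems.RootDecomp1EScaleTransfer (expPoly prod_exp_pow_eq expPoly_eq_sum
  differentiable_expPoly exists_lipschitz_expPoly linearIndependent_scale linearIndependent_of_scale s2 s2_mul_s2 ω4 y3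
  isAlgebraic_s2 ω4_algebraic ω4_linearIndependent y3_linearIndependent s2_not_rat y3_zero y3_one y3_two ih_at_three)

namespace Summit.Schanuel.Schanuel.Theorems.RootDecomp1EPointTransfer

/-! ## §1 Exponential polynomials in the scale: `t ↦ P(e^{t y₁}, …, e^{t yₙ})` — PORT: = `RootDecomp1EScaleTransfer01` §1, opened above -/

/-! ## §2 The INPUT: Roy's point-explicit Lindemann–Weierstrass measure, as a named fact -/

/-- Roy's `S = 6dt(t!)D`. -/
def royS (d t D : ℕ) : ℕ := 6 * d * t * t.factorial * D

/-- Roy's lower bound `H^{−3dS^t} · exp(−(cqS)^{18 S^t})`. -/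
def royBound (t : ℕ) (c : ℝ) (q d D H : ℕ) : ℝ :=
  ((H : ℝ) ^ (3 * d * royS d t D ^ t))⁻¹ *
    Real.exp (-((c * q * (royS d t D : ℕ)) ^ (18 * royS d t D ^ t)))

/-- **NAMED FACT [Roy2014, Théorème 1.1]** (D. Roy, *Une version effective du théorème de
Lindemann–Weierstrass par des méthodes d'indépendance algébrique*, L'Enseignement Math. 59 (2014) 287–306,
doi:10.4171/lem/59-3-4 = arXiv:1607.00579, Thm 1.1 p. 2; homogeneous form Thm 6.3 p. 13), typed print-faithfully:
«Soient `α₁, …, α_t ∈ ℂ` des nombres algébriques linéairement indépendants sur `ℚ`.  Soit `c` un majorant des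
valeurs absolues de tous leurs conjugués, soit `q ∈ ℕ` un entier positif tel que `qα₁, …, qα_t` soient des
entiers algébriques, et soit `d` le degré de `ℚ(α₁, …, α_t)` sur `ℚ`.  Pour toute paire d'entiers positifs `D`
et `H` et tout polynôme non nul `P ∈ ℤ[X₁, …, X_t]` de degré au plus `D` à coefficients entiers en valeur
absolue au plus `H`, on a `|P(e^{α₁}, …, e^{α_t})| ≥ H^{−3dS^t} exp(−(cqS)^{18S^t})`, où `S = 6dt(t!)D`.»
The conjugates of `α_i` are rendered as the values `σ(α_i)` over all ℚ-embeddings `σ : F → ℂ` of any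
finite-dimensional subfield `F ∋ α_i` of `ℂ` (the same finite set for every such `F`).  An unproved-in-tree
published theorem: used below only as the hypothesis `(hRoy : Roy2014_thm_1_1)`.
[cite arXiv:1607.00579 Thm 1.1; doi:10.4171/LEM/59-3-4] -/
def Roy2014_thm_1_1 : Prop :=
  ∀ (t : ℕ) (α : Fin t → ℂ), (∀ i, IsAlgebraic ℚ (α i)) → LinearIndependent ℚ α →
  ∀ (F : IntermediateField ℚ ℂ) (hF : ∀ i, α i ∈ F), FiniteDimensional ℚ F →
  ∀ (c : ℝ), (∀ (σ : F →ₐ[ℚ] ℂ) (i : Fin t), ‖σ ⟨α i, hF i⟩‖ ≤ c) →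
  ∀ (q : ℕ), 0 < q → (∀ i, IsIntegral ℤ ((q : ℂ) * α i)) →
  ∀ (d : ℕ), Module.finrank ℚ (IntermediateField.adjoin ℚ (Set.range α)) = d →
  ∀ (D H : ℕ), 0 < D → 0 < H →
  ∀ (P : MvPolynomial (Fin t) ℤ), P ≠ 0 → P.totalDegree ≤ D → (∀ m, |P.coeff m| ≤ (H : ℤ)) →
    royBound t c q d D H ≤ ‖MvPolynomial.aeval (fun i => cexp (α i)) P‖

/-! ## §3 The cut predicate ON THE SCALE and its tree instances -/

/-- **`HyperRatScale ξ`** — the scale `ξ` is approximable by non-zero RATIONALS to SINGLE-exponential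
order `m`, for every `m`: `‖ξ − r‖ < exp(−(2 + |num r| + den r)^m)`. -/
def HyperRatScale (ξ : ℂ) : Prop :=
  ∀ m : ℕ, ∃ r : ℚ, r ≠ 0 ∧ ‖ξ - (r : ℂ)‖ < Real.exp (-((2 + |(r.num : ℝ)| + r.den) ^ m))

/-- `|num r| = |r| · den r`. -/
theorem abs_num_eq (r : ℚ) : |(r.num : ℝ)| = |(r : ℝ)| * r.den := by
  have e : (r : ℝ) * r.den = r.num := by exact_mod_cast Rat.mul_den_eq_num r
  rw [← e, abs_mul, Nat.abs_cast]

/-- **Every hyper-Liouville real (lens 6's 1K class) is a hyper-rational scale.** -/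
theorem hyperRatScale_of_hyperLiouville {ρ : ℝ} (h : HyperLiouville ρ) : HyperRatScale (ρ : ℂ) := by
  intro m
  obtain ⟨N, hN⟩ := exists_nat_ge (|ρ| + 4)
  obtain ⟨r, hden, hne, hlt⟩ := h (2 * m + N + 2)
  have hden1 : (1 : ℝ) ≤ r.den := by exact_mod_cast r.den_pos
  have hdenN : |ρ| + 4 ≤ r.den := hN.trans (by exact_mod_cast (show N ≤ r.den by omega))
  have hr0 : r ≠ 0 := by
    rintro rfl
    simp at hden
  have hclose : |ρ - r| < 1 := by
    refine hlt.trans_le ?_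
    have : (0 : ℝ) ≤ (r.den : ℝ) ^ (2 * m + N + 2) := by positivity
    exact Real.exp_le_one_iff.mpr (neg_nonpos.mpr this)
  have hrabs : |(r : ℝ)| ≤ |ρ| + 1 := by
    have := abs_sub_abs_le_abs_sub (r : ℝ) ρ
    rw [abs_sub_comm] at this
    linarith
  have hbase : 2 + |(r.num : ℝ)| + r.den ≤ (r.den : ℝ) ^ 2 := by
    rw [abs_num_eq]
    have h1 : |(r : ℝ)| * r.den ≤ (|ρ| + 1) * r.den := by gcongr
    nlinarith [abs_nonneg ρ]
  refine ⟨r, hr0, ?_⟩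
  have hnorm : ‖(ρ : ℂ) - (r : ℂ)‖ = |ρ - r| := by
    rw [show ((r : ℚ) : ℂ) = ((r : ℝ) : ℂ) by norm_cast, ← Complex.ofReal_sub, Complex.norm_real,
      Real.norm_eq_abs]
  rw [hnorm]
  refine hlt.trans_le (Real.exp_le_exp.mpr (neg_le_neg ?_))
  have hb0 : (0 : ℝ) ≤ 2 + |(r.num : ℝ)| + r.den := by positivity
  calc (2 + |(r.num : ℝ)| + r.den) ^ m ≤ ((r.den : ℝ) ^ 2) ^ m := pow_le_pow_left₀ hb0 hbase m
    _ = (r.den : ℝ) ^ (2 * m) := by rw [← pow_mul]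
    _ ≤ (r.den : ℝ) ^ (2 * m + N + 2) := pow_le_pow_right₀ hden1 (by omega)

/-- The bottom instance: `ξ = 1` (distance `0`): algebraic points themselves. -/
theorem hyperRatScale_one : HyperRatScale 1 := fun m =>
  ⟨1, one_ne_zero, by rw [Rat.cast_one, sub_self, norm_zero]; exact Real.exp_pos _⟩

/-! ### §3b Frame data: the field `ℚ(y)`, a denominator, a house bound -/

/-- `ℚ(r·y) = ℚ(y)` for `r ∈ ℚˣ`. -/
theorem adjoin_range_smul {n : ℕ} (y : Fin n → ℂ) {r : ℚ} (hr : r ≠ 0) :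
    IntermediateField.adjoin ℚ (Set.range fun j => (r : ℂ) * y j) =
      IntermediateField.adjoin ℚ (Set.range y) := by
  apply le_antisymm
  · rw [IntermediateField.adjoin_le_iff]
    rintro _ ⟨j, rfl⟩
    exact mul_mem (IntermediateField.algebraMap_mem _ r)
      (IntermediateField.subset_adjoin _ _ ⟨j, rfl⟩)
  · rw [IntermediateField.adjoin_le_iff]
    rintro _ ⟨j, rfl⟩
    have hm : (r : ℂ) * y j ∈ IntermediateField.adjoin ℚ (Set.range fun j => (r : ℂ) * y j) :=
      IntermediateField.subset_adjoin _ _ ⟨j, rfl⟩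
    have hr' : (r : ℂ) ≠ 0 := by exact_mod_cast hr
    have : y j = (r⁻¹ : ℚ) * ((r : ℂ) * y j) := by push_cast; field_simp
    rw [this]
    exact mul_mem (IntermediateField.algebraMap_mem _ r⁻¹) hm

/-- `ℚ(y)` is a number field for `y` algebraic. -/
theorem finiteDimensional_adjoin_range {n : ℕ} {y : Fin n → ℂ} (hy : ∀ j, IsAlgebraic ℚ (y j)) :
    FiniteDimensional ℚ (IntermediateField.adjoin ℚ (Set.range y)) :=
  IntermediateField.finiteDimensional_adjoin fun x hx => by
    obtain ⟨j, rfl⟩ := hx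
    exact (hy j).isIntegral

/-- A common denominator: `q ∈ ℕ⁺` with all `q·y_j` algebraic integers. -/
theorem exists_den {n : ℕ} {y : Fin n → ℂ} (hy : ∀ j, IsAlgebraic ℚ (y j)) :
    ∃ q : ℕ, 0 < q ∧ ∀ j, IsIntegral ℤ ((q : ℂ) * y j) := by
  have h1 : ∀ j, ∃ b : ℕ, 0 < b ∧ IsIntegral ℤ ((b : ℂ) * y j) := by
    intro j
    have hZ : IsAlgebraic ℤ (y j) := (IsFractionRing.isAlgebraic_iff ℤ ℚ ℂ).mpr (hy j)
    obtain ⟨b, hb0, hint⟩ := hZ.exists_integral_multiple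
    refine ⟨b.natAbs, Int.natAbs_pos.mpr hb0, ?_⟩
    have hcast : ((b.natAbs : ℕ) : ℂ) = ((b.natAbs : ℤ) : ℂ) := (Int.cast_natCast _).symm
    rcases Int.natAbs_eq b with h | h
    · rw [hcast, ← h, ← zsmul_eq_mul]; exact hint
    · rw [hcast, show (b.natAbs : ℤ) = -b by omega, Int.cast_neg, neg_mul, ← zsmul_eq_mul]
      exact hint.neg
  choose b hb0 hbint using h1
  refine ⟨∏ j, b j, Finset.prod_pos fun j _ => hb0 j, fun j => ?_⟩
  have e : ((∏ i, b i : ℕ) : ℂ) * y j =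
      ((∏ i ∈ Finset.univ.erase j, b i : ℕ) : ℤ) * ((b j : ℂ) * y j) := by
    rw [← Finset.mul_prod_erase Finset.univ b (Finset.mem_univ j)]
    push_cast; ring
  rw [e]
  exact isIntegral_algebraMap.mul (hbint j)

/-- An embedding sends an element to a root of any rational polynomial it satisfies. -/
theorem embedding_mem_roots {F : IntermediateField ℚ ℂ} (x : F) (σ : F →ₐ[ℚ] ℂ)
    (p : Polynomial ℚ) (hp : p ≠ 0) (hx : Polynomial.aeval (x : ℂ) p = 0) :
    σ x ∈ (p.map (algebraMap ℚ ℂ)).roots := by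
  rw [Polynomial.mem_roots (Polynomial.map_ne_zero hp), Polynomial.IsRoot.def, Polynomial.eval_map,
    ← Polynomial.aeval_def, Polynomial.aeval_algHom_apply]
  have h0 : Polynomial.aeval x p = 0 := by
    apply (IntermediateField.val F).toRingHom.injective
    rw [map_zero]
    change (IntermediateField.val F) (Polynomial.aeval x p) = 0
    rw [← Polynomial.aeval_algHom_apply]
    exact hx
  rw [h0, map_zero]

/-- A HOUSE bound for the frame: `‖σ(y_j)‖ ≤ c_y` for every ℚ-embedding `σ` of `F ∋ y`. -/
theorem exists_house {n : ℕ} {y : Fin n → ℂ} (hy : ∀ j, IsAlgebraic ℚ (y j))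
    (F : IntermediateField ℚ ℂ) (hyF : ∀ j, y j ∈ F) :
    ∃ c : ℝ, 0 ≤ c ∧ ∀ (σ : F →ₐ[ℚ] ℂ) (j : Fin n), ‖σ ⟨y j, hyF j⟩‖ ≤ c := by
  classical
  let R : Fin n → Finset ℂ := fun j => (((minpoly ℚ (y j)).map (algebraMap ℚ ℂ)).roots).toFinset
  refine ⟨∑ j, ∑ x ∈ R j, ‖x‖,
    Finset.sum_nonneg fun j _ => Finset.sum_nonneg fun x _ => norm_nonneg x, fun σ j => ?_⟩
  have hmem : σ ⟨y j, hyF j⟩ ∈ R j := by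
    rw [Multiset.mem_toFinset]
    exact embedding_mem_roots ⟨y j, hyF j⟩ σ (minpoly ℚ (y j)) (minpoly.ne_zero (hy j).isIntegral)
      (minpoly.aeval ℚ (y j))
  calc ‖σ ⟨y j, hyF j⟩‖ ≤ ∑ x ∈ R j, ‖x‖ :=
        Finset.single_le_sum (f := fun x => ‖x‖) (fun x _ => norm_nonneg x) hmem
    _ ≤ ∑ j, ∑ x ∈ R j, ‖x‖ :=
        Finset.single_le_sum (f := fun j => ∑ x ∈ R j, ‖x‖)
          (fun j _ => Finset.sum_nonneg fun x _ => norm_nonneg x) (Finset.mem_univ j)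

/-- `exp(−x) ≤ 1/x` for `x > 0`. -/
private theorem exp_neg_le_one_div {x : ℝ} (hx : 0 < x) : Real.exp (-x) ≤ 1 / x := by
  rw [Real.exp_neg, ← one_div]
  exact one_div_le_one_div_of_le hx (by linarith [Real.add_one_le_exp x])

end Summit.Schanuel.Schanuel.Theorems.RootDecomp1EPointTransfer
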